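import Mathlib
import Summits.NavierStokesRegularity.NavierStokesRegularity.Theorems.FilamentSkeletonRssStadiumTentFreezeNhds
import Summits.NavierStokesRegularity.NavierStokesRegularity.Theorems.FilamentSkeletonRssStadiumQuarterFeetFrozen
import Summits.NavierStokesRegularity.NavierStokesRegularity.Theorems.FilamentSkeletonRssStadiumRightWingGeneral
import Summits.NavierStokesRegularity.NavierStokesRegularity.Theorems.FilamentSkeletonRssStadiumLeftWingPos

/-!
# Route `FilamentSkeletonRss` · cruxes `SkeletonJ1L` (stmt-NavierStokesRegularity-23296, registered stub `stub_tangentSkeletonL` ≡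
# `TangentSkeletonNearStraightL`, stmt-23320) · line `child_tangent_analytic_strip_L` (b0b56c52900dd90a), stub `stub_stripPropagation` —
# assembly for `rcore`: THE SYMMETRIC QUARTER-WIDTH TENT IS FROZEN NEAR EVERY ANCHOR, HENCE HOLOMORPHIC ON THE QUARTER STADIUM

The own-filament continuation of the quarter programme at a complex target `z` is the kernel of target `z` integrated over the SYMMETRIC TENT of `z`:
left foot `σ ≤ Re z − hs/2` (real sources), polygon `Re z − hs/2 → z − hs/5 → z → z + hs/5 → Re z + hs/2` (complex sources), right foot
`σ > Re z + hs/2`.  `tent_frozen_nhds`: for every anchor `z₀` of the quarter stadium `Q = {|Im z| < hs/4, |Re z − cc| < L + hs/4}` ALL hypotheses of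
`Theorems.StadiumTentFreezeNhds.tent_eq_frozen_nhds_sharp` are discharged from landed bricks — segments in the stadium (here), pointwise positivity
(`Theorems.StadiumRightWingGeneral.right_wing_pos_general`, `Theorems.StadiumLeftWingPos.left_wing_pos_general`), 1-Lipschitz vertices (here), feet
(`Theorems.StadiumQuarterFeetFrozen`) — so on a ball about `z₀` the tent field equals the frozen-tent field of `z₀`, which is holomorphic.
`tent_differentiableOn`: the tent field is holomorphic on `Q` (`Theorems.StadiumSourceHolomorphic.differentiableOn_of_locally_eq`) — the HOLOMORPHY
CLAUSE of the own term of `rcore`.  Kernels `f`, `g` and the vertex map `V` enter through defining equations (as the stub's `u` does).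
HONEST FRAMING: bookkeeping for a HYPOTHETICAL filament skeleton on the NEGATIVE side of a MODEL route; the stub `stub_stripPropagation` is NOT closed
by this file (real trace ✓ elsewhere, the explicit BOUND and the Γ-asymptotics remain), `TangentSkeletonNearStraightL` / `SkeletonJ1L` stay OPEN;
nothing here bears on Navier–Stokes regularity or blow-up.  `--supports stmt-NavierStokesRegularity-23320` (≡ stub `stub_tangentSkeletonL` of 23296).
-/

set_option linter.dupNamespace false

noncomputable section

namespace Summit.NavierStokesRegularity.NavierStokesRegularity.Theorems.StadiumTentNhds

open Set Filter Topology Complex MeasureTheory Metric Finset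
open scoped InnerProductSpace Matrix
open Summit.NavierStokesRegularity.NavierStokesRegularity.Theorems.StadiumTentFreezeNhds
open Summit.NavierStokesRegularity.NavierStokesRegularity.Theorems.StadiumQuarterFeetFrozen
open Summit.NavierStokesRegularity.NavierStokesRegularity.Theorems.StadiumRightWingGeneral
open Summit.NavierStokesRegularity.NavierStokesRegularity.Theorems.StadiumLeftWingPos
open Summit.NavierStokesRegularity.NavierStokesRegularity.Theorems.StadiumSourceHolomorphic
open Summit.NavierStokesRegularity.NavierStokesRegularity.Theorems.StadiumPartnerPiece

/-- The five vertices of the symmetric tent are 1-Lipschitz in the target. [folklore] -/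
theorem tent_vertices_lipschitz {hs : ℝ} {V : ℂ → ℕ → ℂ}
    (hV0 : ∀ z, V z 0 = ((z.re - hs / 2 : ℝ) : ℂ)) (hV1 : ∀ z, V z 1 = z - ((hs / 5 : ℝ) : ℂ)) (hV2 : ∀ z, V z 2 = z)
    (hV3 : ∀ z, V z 3 = z + ((hs / 5 : ℝ) : ℂ)) (hV4 : ∀ z, V z 4 = ((z.re + hs / 2 : ℝ) : ℂ)) :
    ∀ z w, ∀ k ≤ 4, dist (V z k) (V w k) ≤ dist z w := by
  intro z w k hk
  have hre : dist z.re w.re ≤ dist z w := by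
    rw [Real.dist_eq, dist_eq_norm, ← Complex.sub_re]; exact Complex.abs_re_le_norm _
  interval_cases k
  · rw [hV0, hV0, dist_eq_norm, ← Complex.ofReal_sub, Complex.norm_real, Real.norm_eq_abs,
      show z.re - hs / 2 - (w.re - hs / 2) = z.re - w.re by ring, ← Real.dist_eq]; exact hre
  · rw [hV1, hV1, dist_eq_norm, dist_eq_norm, show z - ((hs / 5 : ℝ) : ℂ) - (w - ((hs / 5 : ℝ) : ℂ)) = z - w by ring]
  · rw [hV2, hV2]
  · rw [hV3, hV3, dist_eq_norm, dist_eq_norm, show z + ((hs / 5 : ℝ) : ℂ) - (w + ((hs / 5 : ℝ) : ℂ)) = z - w by ring]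
  · rw [hV4, hV4, dist_eq_norm, ← Complex.ofReal_sub, Complex.norm_real, Real.norm_eq_abs,
      show z.re + hs / 2 - (w.re + hs / 2) = z.re - w.re by ring, ← Real.dist_eq]; exact hre

/-- The four segments of the symmetric tent of an anchor of the quarter stadium lie in the stadium. [folklore] -/
theorem tent_segments_in_stadium {hs L cc : ℝ} (hhs : 0 < hs) {V : ℂ → ℕ → ℂ}
    (hV0 : ∀ z, V z 0 = ((z.re - hs / 2 : ℝ) : ℂ)) (hV1 : ∀ z, V z 1 = z - ((hs / 5 : ℝ) : ℂ)) (hV2 : ∀ z, V z 2 = z)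
    (hV3 : ∀ z, V z 3 = z + ((hs / 5 : ℝ) : ℂ)) (hV4 : ∀ z, V z 4 = ((z.re + hs / 2 : ℝ) : ℂ))
    {z₀ : ℂ} (hz₀im : |z₀.im| < hs / 4) (hz₀re : |z₀.re - cc| < L + hs / 4) :
    ∀ k < 4, ∀ t ∈ Icc (0:ℝ) 1,
      V z₀ k + (t : ℂ) * (V z₀ (k+1) - V z₀ k) ∈ {z : ℂ | |z.im| < hs ∧ |z.re - cc| < L + hs} := by
  have hY := abs_lt.mp hz₀im
  have hx := abs_lt.mp hz₀re
  intro k hk t ht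
  have h1t : |t| ≤ 1 := by rw [abs_le]; constructor <;> linarith [ht.1, ht.2]
  have hYt : |z₀.im| * |t| < hs := by
    calc |z₀.im| * |t| ≤ |z₀.im| * 1 := mul_le_mul_of_nonneg_left h1t (abs_nonneg _)
      _ < hs := by linarith
  have h1t' : |1 - t| ≤ 1 := by rw [abs_le]; constructor <;> linarith [ht.1, ht.2]
  have hYt' : |z₀.im| * |1 - t| < hs := by
    calc |z₀.im| * |1 - t| ≤ |z₀.im| * 1 := mul_le_mul_of_nonneg_left h1t' (abs_nonneg _)
      _ < hs := by linarith
  interval_cases k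
  · rw [hV0, hV1]
    refine ⟨?_, ?_⟩
    · simp; rw [mul_comm]; exact hYt
    · simp; rw [abs_lt]; constructor <;> nlinarith [ht.1, ht.2]
  · rw [hV1, hV2]
    refine ⟨?_, ?_⟩
    · simp; linarith
    · simp; rw [abs_lt]; constructor <;> nlinarith [ht.1, ht.2]
  · rw [hV2, hV3]
    refine ⟨?_, ?_⟩
    · simp; linarith
    · simp; rw [abs_lt]; constructor <;> nlinarith [ht.1, ht.2]
  · rw [hV3, hV4]
    refine ⟨?_, ?_⟩
    · simp
      rw [show z₀.im + -(t * z₀.im) = z₀.im * (1 - t) by ring, abs_mul]; exact hYt'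
    · simp; rw [abs_lt]; constructor <;> nlinarith [ht.1, ht.2]

/-- **The symmetric tent is frozen near every anchor of the quarter stadium.**  Stadium data (`F` holomorphic on `S` with `‖F′‖ ≤ 2`, `Σ (F′)ᵢ² = 1`,
real trace `X ∈ C¹` of unit speed and tangent oscillation `≤ Rb ≤ 1/2`; core continuation `G` holomorphic on `S` with real trace `A` (continuous,
`≥ 0`) and `Re G ≥ g₀ > 0`; `κ > 0`); kernels `f`, `g` and tent vertices `V` by their defining equations; anchor `z₀ ∈ Q`.  Then on a ball
`B(z₀, δ) ⊆ S` the frozen-tent field of `z₀` is holomorphic and equals the tent field. [folklore] -/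
theorem tent_frozen_nhds {hs L cc : ℝ} {F : ℂ → (Fin 3 → ℂ)}
    (hF : DifferentiableOn ℂ F {z : ℂ | |z.im| < hs ∧ |z.re - cc| < L + hs})
    (hM : ∀ z ∈ {z : ℂ | |z.im| < hs ∧ |z.re - cc| < L + hs}, ‖deriv F z‖ ≤ 2)
    (hunit : ∀ w ∈ {z : ℂ | |z.im| < hs ∧ |z.re - cc| < L + hs}, ∑ i, (deriv F w i) ^ 2 = 1)
    {X : ℝ → EuclideanSpace ℝ (Fin 3)} (hX : ContDiff ℝ 1 X) (hXu : ∀ τ, ‖deriv X τ‖ = 1)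
    {Rb : ℝ} (hRb0 : 0 ≤ Rb) (hRb : Rb ≤ 1 / 2) (hosc : ∀ τ σ, ‖deriv X τ - deriv X σ‖ ≤ Rb)
    (hFX : ∀ r : ℝ, (r : ℂ) ∈ {z : ℂ | |z.im| < hs ∧ |z.re - cc| < L + hs} →
      F r = fun i => ((⟪X r, EuclideanSpace.single i (1:ℝ)⟫_ℝ : ℝ) : ℂ))
    {G : ℂ → ℂ} (hG : DifferentiableOn ℂ G {z : ℂ | |z.im| < hs ∧ |z.re - cc| < L + hs})
    {A : ℝ → ℝ} (hGX : ∀ r : ℝ, (r : ℂ) ∈ {z : ℂ | |z.im| < hs ∧ |z.re - cc| < L + hs} → G r = ((A r : ℝ) : ℂ))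
    (hAc : Continuous A) (hA0 : ∀ σ, 0 ≤ A σ)
    {κ g₀ : ℝ} (hκ : 0 < κ) (hg₀ : 0 < g₀) (hGre : ∀ w ∈ {z : ℂ | |z.im| < hs ∧ |z.re - cc| < L + hs}, g₀ ≤ (G w).re)
    (hhs : 0 < hs)
    {f : ℂ → ℂ → (Fin 3 → ℂ)}
    (hf : ∀ z ζ, f z ζ = (((∑ i, (F z i - F ζ i) ^ 2) + (κ : ℂ) * G ζ) ^ ((3:ℂ) / 2))⁻¹ •
      (deriv F ζ ⨯₃ (fun i => F z i - F ζ i)))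
    {g : ℂ → ℝ → (Fin 3 → ℂ)}
    (hg : ∀ z σ, g z σ = (((∑ i, (F z i - ((X σ i : ℝ) : ℂ)) ^ 2) + ((κ * A σ : ℝ) : ℂ)) ^ ((3:ℂ) / 2))⁻¹ •
      ((fun i => ((deriv X σ i : ℝ) : ℂ)) ⨯₃ (fun i => F z i - ((X σ i : ℝ) : ℂ))))
    {V : ℂ → ℕ → ℂ}
    (hV0 : ∀ z, V z 0 = ((z.re - hs / 2 : ℝ) : ℂ)) (hV1 : ∀ z, V z 1 = z - ((hs / 5 : ℝ) : ℂ)) (hV2 : ∀ z, V z 2 = z)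
    (hV3 : ∀ z, V z 3 = z + ((hs / 5 : ℝ) : ℂ)) (hV4 : ∀ z, V z 4 = ((z.re + hs / 2 : ℝ) : ℂ))
    {z₀ : ℂ} (hz₀im : |z₀.im| < hs / 4) (hz₀re : |z₀.re - cc| < L + hs / 4) :
    ∃ δ : ℝ, 0 < δ ∧ ball z₀ δ ⊆ {z : ℂ | |z.im| < hs ∧ |z.re - cc| < L + hs} ∧
      DifferentiableOn ℂ (fun z => (∫ σ in Iic (z₀.re - hs / 2), g z σ) +
        (∑ k ∈ range 4, ∫ t in (0:ℝ)..1, (V z₀ (k+1) - V z₀ k) • f z (V z₀ k + (t : ℂ) * (V z₀ (k+1) - V z₀ k))) +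
        ∫ σ in Ioi (z₀.re + hs / 2), g z σ) (ball z₀ δ) ∧
      ∀ z ∈ ball z₀ δ,
        (∫ σ in Iic (z.re - hs / 2), g z σ) +
            (∑ k ∈ range 4, ∫ t in (0:ℝ)..1, (V z (k+1) - V z k) • f z (V z k + (t : ℂ) * (V z (k+1) - V z k))) +
            (∫ σ in Ioi (z.re + hs / 2), g z σ) =
          (∫ σ in Iic (z₀.re - hs / 2), g z σ) +
            (∑ k ∈ range 4, ∫ t in (0:ℝ)..1, (V z₀ (k+1) - V z₀ k) • f z (V z₀ k + (t : ℂ) * (V z₀ (k+1) - V z₀ k))) +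
            ∫ σ in Ioi (z₀.re + hs / 2), g z σ := by
  set S : Set ℂ := {z : ℂ | |z.im| < hs ∧ |z.re - cc| < L + hs} with hS
  have hz₀S : z₀ ∈ S := ⟨by linarith, by linarith⟩
  have hgz : ∀ z, g z = fun σ => (((∑ i, (F z i - ((X σ i : ℝ) : ℂ)) ^ 2) + ((κ * A σ : ℝ) : ℂ)) ^ ((3:ℂ) / 2))⁻¹ •
      ((fun i => ((deriv X σ i : ℝ) : ℂ)) ⨯₃ (fun i => F z i - ((X σ i : ℝ) : ℂ))) := fun z => funext (hg z)
  set x₀ : ℝ := z₀.re with hx₀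
  set Y₀ : ℝ := z₀.im with hY₀
  have ez : (x₀ : ℂ) + (Y₀ : ℂ) * Complex.I = z₀ := Complex.re_add_im z₀
  -- the feet
  obtain ⟨δR, hδR, hdiffR, hintR⟩ := quarter_right_foot_frozen hF hM hunit hX hXu hRb0 hRb hosc hFX hAc hA0 hκ.le hhs hz₀im hz₀re
  obtain ⟨δL, hδL, hdiffL, hintL⟩ := quarter_left_foot_frozen hF hM hunit hX hXu hRb0 hRb hosc hFX hAc hA0 hκ.le hhs hz₀im hz₀re
  -- pointwise positivity along the four segments
  obtain ⟨hposL0, hposL1⟩ := left_wing_pos_general hF hM hunit hX hXu hRb0 hRb hosc hFX hhs hz₀im hz₀re hκ hg₀ hGre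
  obtain ⟨hposR0, hposR1⟩ := right_wing_pos_general hF hM hunit hX hXu hRb0 hRb hosc hFX hhs hz₀im hz₀re hκ hg₀ hGre
  have hpos : ∀ k < 4, ∀ t ∈ Icc (0:ℝ) 1,
      0 < ((∑ i, (F z₀ i - F (V z₀ k + (t : ℂ) * (V z₀ (k+1) - V z₀ k)) i) ^ 2) +
        (κ : ℂ) * G (V z₀ k + (t : ℂ) * (V z₀ (k+1) - V z₀ k))).re := by
    intro k hk t ht
    interval_cases k
    · have e : V z₀ 0 + (t : ℂ) * (V z₀ (0+1) - V z₀ 0) = ((x₀ - hs / 2 : ℝ) : ℂ) + (t : ℂ) *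
          ((((x₀ - hs / 5 : ℝ) : ℂ) + (Y₀ : ℂ) * Complex.I) - ((x₀ - hs / 2 : ℝ) : ℂ)) := by
        rw [hV0, hV1]; apply Complex.ext <;> simp [hx₀, hY₀]
      have h := hposL0 t ht
      rw [ez] at h; rw [e]; exact h
    · have e : V z₀ 1 + (t : ℂ) * (V z₀ (1+1) - V z₀ 1) = (((x₀ - hs / 5 : ℝ) : ℂ) + (Y₀ : ℂ) * Complex.I) + (t : ℂ) *
          (z₀ - (((x₀ - hs / 5 : ℝ) : ℂ) + (Y₀ : ℂ) * Complex.I)) := by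
        rw [hV1, hV2]; apply Complex.ext <;> simp [hx₀, hY₀]
      have h := hposL1 t ht
      rw [ez] at h; rw [e]; exact h
    · have e : V z₀ 2 + (t : ℂ) * (V z₀ (2+1) - V z₀ 2) = z₀ + (t : ℂ) * ((z₀ + ((hs / 5 : ℝ) : ℂ)) - z₀) := by
        rw [hV2, hV3]
      have h := hposR0 t ht
      rw [ez] at h; rw [e]; exact h
    · have e : V z₀ 3 + (t : ℂ) * (V z₀ (3+1) - V z₀ 3) = (((x₀ + hs / 5 : ℝ) : ℂ) + (Y₀ : ℂ) * Complex.I) + (t : ℂ) *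
          (((x₀ + hs / 2 : ℝ) : ℂ) - (((x₀ + hs / 5 : ℝ) : ℂ) + (Y₀ : ℂ) * Complex.I)) := by
        rw [hV3, hV4]; apply Complex.ext <;> simp [hx₀, hY₀]
      have h := hposR1 t ht
      rw [ez] at h; rw [e]; exact h
  -- the radius for the feet hypotheses
  set η : ℝ := min (min δL δR) (hs / 4) with hηdef
  have hη : 0 < η := lt_min (lt_min hδL hδR) (by positivity)
  have hηL : η ≤ δL := (min_le_left _ _).trans (min_le_left _ _)
  have hηR : η ≤ δR := (min_le_left _ _).trans (min_le_right _ _)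
  have hη4 : η ≤ hs / 4 := min_le_right _ _
  have hx := abs_lt.mp hz₀re
  have hℓrange : ∀ σ : ℝ, |σ - (fun z : ℂ => z.re - hs / 2) z₀| < η → |σ - cc| < L + hs := by
    intro σ hσ
    have h := abs_lt.mp hσ
    simp only [] at h
    rw [abs_lt]; constructor <;> linarith [h.1, h.2]
  have hrrange : ∀ σ : ℝ, |σ - (fun z : ℂ => z.re + hs / 2) z₀| < η → |σ - cc| < L + hs := by
    intro σ hσ
    have h := abs_lt.mp hσ
    simp only [] at h
    rw [abs_lt]; constructor <;> linarith [h.1, h.2]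
  have hint : ∀ z ∈ ball z₀ η, IntegrableOn (g z) (Iic ((fun z : ℂ => z.re - hs / 2) z₀)) ∧
      IntegrableOn (g z) (Iic ((fun z : ℂ => z.re - hs / 2) z)) ∧
      IntegrableOn (g z) (Ioi ((fun z : ℂ => z.re + hs / 2) z₀)) ∧ IntegrableOn (g z) (Ioi ((fun z : ℂ => z.re + hs / 2) z)) := by
    intro z hz
    have hzL := hintL z (ball_subset_ball hηL hz)
    have hzR := hintR z (ball_subset_ball hηR hz)
    simp only [hgz]
    exact ⟨hzL.1, hzL.2, hzR.1, hzR.2⟩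
  have hfeet : DifferentiableOn ℂ (fun z => ∫ σ in Iic ((fun z : ℂ => z.re - hs / 2) z₀), g z σ) (ball z₀ η) ∧
      DifferentiableOn ℂ (fun z => ∫ σ in Ioi ((fun z : ℂ => z.re + hs / 2) z₀), g z σ) (ball z₀ η) := by
    simp only [hgz]
    exact ⟨hdiffL.mono (ball_subset_ball hηL), hdiffR.mono (ball_subset_ball hηR)⟩
  have hV0' : ∀ z, V z 0 = (((fun z : ℂ => z.re - hs / 2) z : ℝ) : ℂ) := fun z => by simp only [hV0]
  have hV4' : ∀ z, V z 4 = (((fun z : ℂ => z.re + hs / 2) z : ℝ) : ℂ) := fun z => by simp only [hV4]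
  have key := tent_eq_frozen_nhds_sharp hF hM zero_le_two hG hX.differentiable_one hFX hGX hhs hf hg hV0' hV4'
    (tent_vertices_lipschitz hV0 hV1 hV2 hV3 hV4) hz₀S (tent_segments_in_stadium hhs hV0 hV1 hV2 hV3 hV4 hz₀im hz₀re) hpos hη
    hℓrange hrrange hint hfeet
  simpa only using key

/-- **The symmetric tent field is holomorphic on the quarter stadium** (`Q = {|Im z| < hs/4, |Re z − cc| < L + hs/4}`): holomorphy is local and
near every anchor the tent field is the holomorphic frozen-tent field (`tent_frozen_nhds`). [folklore] -/
theorem tent_differentiableOn {hs L cc : ℝ} {F : ℂ → (Fin 3 → ℂ)}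
    (hF : DifferentiableOn ℂ F {z : ℂ | |z.im| < hs ∧ |z.re - cc| < L + hs})
    (hM : ∀ z ∈ {z : ℂ | |z.im| < hs ∧ |z.re - cc| < L + hs}, ‖deriv F z‖ ≤ 2)
    (hunit : ∀ w ∈ {z : ℂ | |z.im| < hs ∧ |z.re - cc| < L + hs}, ∑ i, (deriv F w i) ^ 2 = 1)
    {X : ℝ → EuclideanSpace ℝ (Fin 3)} (hX : ContDiff ℝ 1 X) (hXu : ∀ τ, ‖deriv X τ‖ = 1)
    {Rb : ℝ} (hRb0 : 0 ≤ Rb) (hRb : Rb ≤ 1 / 2) (hosc : ∀ τ σ, ‖deriv X τ - deriv X σ‖ ≤ Rb)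
    (hFX : ∀ r : ℝ, (r : ℂ) ∈ {z : ℂ | |z.im| < hs ∧ |z.re - cc| < L + hs} →
      F r = fun i => ((⟪X r, EuclideanSpace.single i (1:ℝ)⟫_ℝ : ℝ) : ℂ))
    {G : ℂ → ℂ} (hG : DifferentiableOn ℂ G {z : ℂ | |z.im| < hs ∧ |z.re - cc| < L + hs})
    {A : ℝ → ℝ} (hGX : ∀ r : ℝ, (r : ℂ) ∈ {z : ℂ | |z.im| < hs ∧ |z.re - cc| < L + hs} → G r = ((A r : ℝ) : ℂ))
    (hAc : Continuous A) (hA0 : ∀ σ, 0 ≤ A σ)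
    {κ g₀ : ℝ} (hκ : 0 < κ) (hg₀ : 0 < g₀) (hGre : ∀ w ∈ {z : ℂ | |z.im| < hs ∧ |z.re - cc| < L + hs}, g₀ ≤ (G w).re)
    (hhs : 0 < hs)
    {f : ℂ → ℂ → (Fin 3 → ℂ)}
    (hf : ∀ z ζ, f z ζ = (((∑ i, (F z i - F ζ i) ^ 2) + (κ : ℂ) * G ζ) ^ ((3:ℂ) / 2))⁻¹ •
      (deriv F ζ ⨯₃ (fun i => F z i - F ζ i)))
    {g : ℂ → ℝ → (Fin 3 → ℂ)}
    (hg : ∀ z σ, g z σ = (((∑ i, (F z i - ((X σ i : ℝ) : ℂ)) ^ 2) + ((κ * A σ : ℝ) : ℂ)) ^ ((3:ℂ) / 2))⁻¹ •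
      ((fun i => ((deriv X σ i : ℝ) : ℂ)) ⨯₃ (fun i => F z i - ((X σ i : ℝ) : ℂ))))
    {V : ℂ → ℕ → ℂ}
    (hV0 : ∀ z, V z 0 = ((z.re - hs / 2 : ℝ) : ℂ)) (hV1 : ∀ z, V z 1 = z - ((hs / 5 : ℝ) : ℂ)) (hV2 : ∀ z, V z 2 = z)
    (hV3 : ∀ z, V z 3 = z + ((hs / 5 : ℝ) : ℂ)) (hV4 : ∀ z, V z 4 = ((z.re + hs / 2 : ℝ) : ℂ)) :
    DifferentiableOn ℂ (fun z => (∫ σ in Iic (z.re - hs / 2), g z σ) +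
        (∑ k ∈ range 4, ∫ t in (0:ℝ)..1, (V z (k+1) - V z k) • f z (V z k + (t : ℂ) * (V z (k+1) - V z k))) +
        ∫ σ in Ioi (z.re + hs / 2), g z σ) {z : ℂ | |z.im| < hs / 4 ∧ |z.re - cc| < L + hs / 4} := by
  refine differentiableOn_of_locally_eq fun z₀ hz₀ => ?_
  obtain ⟨δ, hδ, -, hdiff, heq⟩ := tent_frozen_nhds hF hM hunit hX hXu hRb0 hRb hosc hFX hG hGX hAc hA0 hκ hg₀ hGre hhs hf hg
    hV0 hV1 hV2 hV3 hV4 hz₀.1 hz₀.2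
  refine ⟨ball z₀ δ, ball_mem_nhds z₀ hδ, _, (hdiff.differentiableAt (ball_mem_nhds z₀ hδ)), fun z hz => ?_⟩
  exact heq z hz

end Summit.NavierStokesRegularity.NavierStokesRegularity.Theorems.StadiumTentNhds

end
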